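/-
Copyright (c) 2026 the pub-hodgecm-mathlib formalisation cell (harness21).  Prover seat hodgecm-mathlib-K2Liu-p02 (g5), Track B «K2-LIT» ∕ hLiu418
#184♮, Road I v3, organ U2f ⇐ = the «τ-bookkeeping» lemma of SIGS U5 (LEAD F0P6-plan (g12∕g13) «M-156d» (3b), M-157c (3), M-157i′).  2026-09-04.
-/
import Summits.HodgeConjecture.HodgeConjecture.Theorems.K2LiuTensorEmbArchFinParts       -- ★ `tensorEmb_archToAdelic`, `IsStd.archToAdelic_archPart_mem` (+ U2f ⇒)
import Summits.HodgeConjecture.HodgeConjecture.Theorems.K2LiuDoubledWeilRepArchPinned     -- ★ D-pin `omega_sD_archToAdelic_tmul` (`ω(s^B(k_∞,1)) = A ⊗ 1` on pure tensors)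
import Literature.RepresentationTheory.HarrisKudlaSweet1996.SplittingCharactersCM          -- ★ `IsSplittingChar.exists_hasUnitaryArchType`
import Mathlib.LinearAlgebra.DirectSum.Finsupp
import HarnessLib

/-!
# K2_Liu road (hLiu418 = stmt-HodgeConjecture-24832), Road I v3 organ U2f (⇐, the «τ-bookkeeping» S-lemma of SIGS U5): #42F′'s `_hΦ` ⇒ `Φ ∈ V ⊗ 𝒮_f`
# for a FINITE-DIMENSIONAL arch space `V` STABLE under the archimedean elements of `𝒦.K`

Cell `pub/hodgecm-mathlib` (D-0151), Track B, build stream 29; binder sheet `K2/K2E5-plan/g6/SIGS-RoadI-v3.md` §2 U2f («conversely #42F′'s `Φ` with `_hΦ` is such an `x` for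
`V_∞ :=` its arch `K_∞`-span») and §2 U5 («Why it might fail: … τ-bookkeeping lemma «`_hΦ` ⇒ finite sum of `K_∞`-finite pure tensors» (S)»).  CONVERSE of ★ p858720
`K2LiuRigidityDomainKFinite` (U2f ⇒) in the currency of ★ p858788 `K2LiuTensorEmbArchFinParts.hV_of_arch`: for ANY Iwasawa datum `𝒦` (no `IsStd` needed), a unitary splitting
character `χ_b` (`IsSplittingChar L 1 χ_b`) and ANY `χ_b`-normalised doubled Weil representation `s^B` of the big datum, every `Φ ∈ 𝒮(𝔸^{n′+n′})` whose `tensorEmb(𝒦.K)`-orbit under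
`ω ∘ s^B` spans a finite-dimensional space (= #42F′'s `_hΦ`, bytes over `s^B`) lies in `E(V ⊗ 𝒮_f)` for a finite-dimensional `V ≤ 𝓢((L⁺ ⊗ ℝ)^{n′+n′})` that the purely
archimedean elements `(a_∞, 1) ∈ 𝒦.K` stabilise slot-wise — so `Φ = Σ_j a_j ⊗ Φ_{f,j}` with every `a_j` `C_∞`-finite, which is what U5's per-place script consumes.

PROOF (no new mathematics): (1) `D := span(orbit)` is finite-dimensional (hypothesis), contains `Φ` (`k = 1`) and is `tensorEmb(𝒦.K)`-stable (group); (2) an archimedean element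
acts on pure tensors by `A ⊗ 1` — ★ D-pin `K2LiuDoubledWeilRepArchPinned.omega_sD_archToAdelic_tmul` (`χ_b` has an odd unitary arch type by ★ `IsSplittingChar.exists_hasUnitaryArchType`)
read through ★ `tensorEmb_archToAdelic`; (3) LINEAR ALGEBRA in a basis `b` of `𝒮_f` (Mathlib `Module.Basis.ofVectorSpace`, `TensorProduct.finsuppScalarRight`): the `b`-coordinates
`κ_i : 𝒮_∞ ⊗ 𝒮_f → 𝒮_∞` satisfy `t = Σ_i κ_i(t) ⊗ b_i` (§0 `mem_span_tmul_of_coord_mem`) and `κ_i ∘ (A ⊗ 1) = A ∘ κ_i` (§0 `coord_map_id`); `V :=` the span of the (finitely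
many non-zero) coordinates of a finite spanning set of `E⁻¹D` is finite-dimensional, contains all coordinates of `E⁻¹D` (linearity), hence `E⁻¹Φ ∈ V ⊗ 𝒮_f`, and is `A`-stable
because `D` is.

* §0 generic (any field): `coord_tmul`, `coord_map_id`, `mem_span_tmul_of_coord_mem`; `exists_linearMap_of_forall_eq_smul_cle` (the `A ⊗ 1` form from the D-pin shape `c • E(T a ⊗ f)`).
* §1 **`exists_archStable_of_finiteDimensional_span_orbit`** (U2f ⇐): `∃ V, FiniteDimensional ℂ V ∧ ‹harch of hV_of_arch› ∧ Φ ∈ span{E(a ⊗ Φ_f) : a ∈ V}`.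

No definition, no instance, no named fact, no `sorry`; axioms ⊆ {propext, Classical.choice, Quot.sound}.  HONEST LABEL: HC_CM is proved only modulo the 7 printed citations
(2 remaining named inputs: hLiu418 = stmt-HodgeConjecture-24832, h413 = stmt-HodgeConjecture-24833) until rung 0 closes; `--supports stmt-HodgeConjecture-24832` helper, count-neutral.
References: [HarrisKudlaSweet1996] M. Harris, S. Kudla, W. J. Sweet, J. AMS 9 (1996), §1 (1.15)–(1.17); [Weil1964] A. Weil, Acta Math. 111 (1964), Chap. III n° 37–38 (`𝐫_𝐀 = ⊗ 𝐫_v`);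
[BorelJacquet1979] A. Borel, H. Jacquet, PSPM 33.1 (1979), §4.1; [GelbartRogawski1991] S. Gelbart, J. Rogawski, Invent. Math. 105 (1991), §3.1 Prop. 3.1.1 p. 455; [Tan1999] V. Tan, §1 p. 166.
-/

set_option autoImplicit false
set_option linter.dupNamespace false
set_option Elab.async false

noncomputable section

open scoped Matrix TensorProduct SchwartzMap Classical
open NumberField NumberField.mixedEmbedding IsDedekindDomain

namespace Summit.HodgeConjecture.HodgeConjecture.Cruxes.HLiu418.K2LiuRigidityDomainKFiniteConverse

open Literature.NumberTheory.Automorphic Literature.NumberTheory.Automorphic.UnitaryGroup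
open Literature.NumberTheory.GaloisRepresentations
open Literature.RepresentationTheory.HarrisKudlaSweet1996
open Literature.NumberTheory.GelbartRogawski1991 Literature.NumberTheory.GelbartRogawski1991.UnitaryDualPair
open Literature.NumberTheory.GelbartRogawski1991.GRConstruction
open Literature.NumberTheory.Weil1964
open Literature.NumberTheory.K2Lit.SiegelDoubled
open Summit.HodgeConjecture.HodgeConjecture.Cruxes.HLiu418.K2LiuTensorEmbArchFinParts
open Summit.HodgeConjecture.HodgeConjecture.Cruxes.HLiu418.K2LiuDoubledWeilRepArchPinned

/-! ## §0 Generic linear algebra: coordinates of a tensor in a basis of the right factor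
(`[DecidableEq ι]` is a PARAMETER so that the lemmas instantiate with the caller's instance — `Decidable` data are not definitionally unique.) -/

section Generic

variable {K : Type*} [Field K] {V₁ V₂ ι : Type*} [DecidableEq ι] [AddCommGroup V₁] [Module K V₁] [AddCommGroup V₂] [Module K V₂] (b : Module.Basis ι K V₂)

/-- the `i`-th `b`-coordinate of a pure tensor: `κ_i(m ⊗ x) = b^*_i(x) • m`. [folklore] -/
theorem coord_tmul (i : ι) (m : V₁) (x : V₂) :
    TensorProduct.finsuppScalarRight K K V₁ ι (TensorProduct.congr (LinearEquiv.refl K V₁) b.repr (m ⊗ₜ[K] x)) i = b.repr x i • m := by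
  rw [TensorProduct.congr_tmul, LinearEquiv.refl_apply, TensorProduct.finsuppScalarRight_apply_tmul_apply]

/-- **naturality of the coordinates**: `κ_i((A ⊗ 1) t) = A(κ_i t)`. [folklore] -/
theorem coord_map_id (A : V₁ →ₗ[K] V₁) (t : V₁ ⊗[K] V₂) (i : ι) :
    TensorProduct.finsuppScalarRight K K V₁ ι (TensorProduct.congr (LinearEquiv.refl K V₁) b.repr (TensorProduct.map A LinearMap.id t)) i =
      A (TensorProduct.finsuppScalarRight K K V₁ ι (TensorProduct.congr (LinearEquiv.refl K V₁) b.repr t) i) := by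
  induction t using TensorProduct.induction_on with
  | zero => simp only [map_zero, Finsupp.coe_zero, Pi.zero_apply]
  | tmul m x => rw [TensorProduct.map_tmul, LinearMap.id_apply, coord_tmul, coord_tmul, map_smul]
  | add x y hx hy => simp only [map_add, Finsupp.coe_add, Pi.add_apply, hx, hy]

/-- **reconstruction**: a tensor all of whose `b`-coordinates lie in a subspace `W ≤ V₁` lies in the span of the pure tensors `w ⊗ x`, `w ∈ W` (`t = Σ_i κ_i(t) ⊗ b_i`). [folklore] -/
theorem mem_span_tmul_of_coord_mem (W : Submodule K V₁) (t : V₁ ⊗[K] V₂)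
    (h : ∀ i, TensorProduct.finsuppScalarRight K K V₁ ι (TensorProduct.congr (LinearEquiv.refl K V₁) b.repr t) i ∈ W) :
    t ∈ Submodule.span K {y : V₁ ⊗[K] V₂ | ∃ w ∈ W, ∃ x : V₂, y = w ⊗ₜ[K] x} := by
  set c := TensorProduct.finsuppScalarRight K K V₁ ι (TensorProduct.congr (LinearEquiv.refl K V₁) b.repr t) with hc
  have ht : t = (TensorProduct.congr (LinearEquiv.refl K V₁) b.repr).symm ((TensorProduct.finsuppScalarRight K K V₁ ι).symm c) := by
    rw [hc, LinearEquiv.symm_apply_apply, LinearEquiv.symm_apply_apply]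
  rw [ht, ← Finsupp.sum_single c, Finsupp.sum, map_sum, map_sum]
  refine Submodule.sum_mem _ fun i _ => ?_
  rw [TensorProduct.finsuppScalarRight_symm_apply_single, TensorProduct.congr_symm_tmul, LinearEquiv.refl_symm, LinearEquiv.refl_apply,
    Module.Basis.repr_symm_single_one]
  exact Submodule.subset_span ⟨c i, h i, b i, rfl⟩

end Generic

/-! ## §0′ The `A ⊗ 1` form of an operator given on pure tensors in the D-pin shape -/

/-- If an endomorphism `Ω` of `𝒮(𝔸^ι)` acts on pure tensors by `Ω(E(a ⊗ f)) = c • E(T a ⊗ f)` (`T` a continuous linear automorphism of the archimedean factor — the shape of ★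
`omega_sD_archToAdelic_tmul`), then `Ω(E(a ⊗ f)) = E(A a ⊗ f)` for the linear map `A = c • T`. [cite: Weil1964, Chap. III n° 37–38 pp. 188–190] -/
theorem exists_linearMap_of_forall_eq_smul_cle {F : Type} [Field F] [NumberField F] {ι : Type} [Fintype ι]
    {Ω : piSchwartzBruhat F ι →ₗ[ℂ] piSchwartzBruhat F ι} {c : ℂ} {T : 𝓢((ι → mixedSpace F), ℂ) ≃L[ℂ] 𝓢((ι → mixedSpace F), ℂ)}
    (h : ∀ (a : 𝓢((ι → mixedSpace F), ℂ)) (f : FinSB F ι), Ω (piSchwartzBruhatEquiv F ι (a ⊗ₜ[ℂ] f)) = c • piSchwartzBruhatEquiv F ι (T a ⊗ₜ[ℂ] f)) :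
    ∃ A : 𝓢((ι → mixedSpace F), ℂ) →ₗ[ℂ] 𝓢((ι → mixedSpace F), ℂ),
      ∀ (a : 𝓢((ι → mixedSpace F), ℂ)) (f : FinSB F ι), Ω (piSchwartzBruhatEquiv F ι (a ⊗ₜ[ℂ] f)) = piSchwartzBruhatEquiv F ι (A a ⊗ₜ[ℂ] f) :=
  ⟨c • (T.toLinearEquiv : 𝓢((ι → mixedSpace F), ℂ) →ₗ[ℂ] 𝓢((ι → mixedSpace F), ℂ)), fun a f => by
    rw [h a f, LinearMap.smul_apply, LinearEquiv.coe_coe, ContinuousLinearEquiv.coe_toLinearEquiv, ← TensorProduct.smul_tmul', map_smul]⟩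

/-! ## §1 U2f (⇐): `_hΦ` ⇒ `Φ ∈ E(V ⊗ 𝒮_f)` with `V` finite-dimensional and stable under the archimedean elements of `𝒦.K` -/

variable (L : Type) [Field L] [NumberField L] [IsCMField L]
variable {N M n : ℕ} (e : Fin N × Fin M ≃ Fin n)
  (dV : Fin N → L) (hdV : ∀ i, IsCMField.complexConj L (dV i) = dV i) (hdV0 : ∀ i, dV i ≠ 0)
  (dW : Fin M → L) (hdW : ∀ i, IsCMField.complexConj L (dW i) = dW i) (hdW0 : ∀ i, dW i ≠ 0)
variable {M₂ M' n' : ℕ} (eW : Fin M × Fin M₂ ≃ Fin M') (e' : Fin N × Fin M' ≃ Fin n')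
  (dV' : Fin M₂ → L) (hdV' : ∀ k, IsCMField.complexConj L (dV' k) = dV' k) (hdV'0 : ∀ k, dV' k ≠ 0)

set_option maxHeartbeats 4000000 in -- the big datum's carrier telescope
/-- **U2f (⇐) — THE «τ-BOOKKEEPING» LEMMA OF SIGS U5.**  Let `𝒦` be ANY Iwasawa datum of the small group `H = U(𝔻)` (`IsStd` is NOT needed here), `χ_b` a unitary splitting character
(`IsSplittingChar L 1 χ_b`) and `s^B` ANY `χ_b`-normalised doubled Weil representation of the big datum `(e′, dV, tensorFrame dW eW dV′)`.  If `Φ ∈ 𝒮(𝔸^{n′+n′})` has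
finite-dimensional `tensorEmb(𝒦.K)`-orbit span under `ω ∘ s^B` (#42F′'s `_hΦ`, bytes over `s^B`), then there is a FINITE-DIMENSIONAL `V ≤ 𝓢((L⁺ ⊗ ℝ)^{n′+n′})`, stable slot-wise under
every purely archimedean `(a_∞, 1) ∈ 𝒦.K` (`∀ a ∈ V, ∃ a′ ∈ V, ∀ Φ_f, ω(s^B((a_∞,1) ⊗ 1)) E(a ⊗ Φ_f) = E(a′ ⊗ Φ_f)` — the `harch` of ★ `hV_of_arch`), with `Φ` in the span of the pure tensors
`E(a ⊗ Φ_f)`, `a ∈ V` — i.e. `Φ = Σ_j a_j ⊗ Φ_{f,j}` with `C_∞`-finite `a_j`.  Together with ★ `finiteDimensional_span_orbit_of_mem_span_tmul_of_isStd` this characterises `_hΦ`.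
[cite: HarrisKudlaSweet1996, §1 (1.15)–(1.17)] [cite: Weil1964, Chap. III n° 37–38 pp. 188–190] [cite: BorelJacquet1979, §4.1] [cite: Tan1999, §1 p. 166] -/
theorem exists_archStable_of_finiteDimensional_span_orbit
    (𝒦 : IwasawaDatum L e dV hdV dW hdW) {χb : HeckeCharacter L} (hχbu : χb.IsUnitary) (hχbs : IsSplittingChar L 1 χb)
    {sB : HA L e' dV hdV (tensorFrame L dW eW dV') (tensorFrame_real L dW hdW eW dV' hdV') →*
      MpD L e' dV hdV (tensorFrame L dW eW dV') (tensorFrame_real L dW hdW eW dV' hdV')}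
    (hsB : IsDoubledWeilRep L e' dV hdV hdV0 (tensorFrame L dW eW dV') (tensorFrame_real L dW hdW eW dV' hdV')
      (tensorFrame_ne_zero L dW eW dV' hdW0 hdV'0) χb sB)
    (Φ : piSchwartzBruhat (Fp L) (Fin (n' + n')))
    (hΦ : FiniteDimensional ℂ (Submodule.span ℂ (Set.range fun k : 𝒦.K =>
      adelicMpCont.omega (Fp L) (Fin (n' + n')) (gramDA L e' dV hdV (tensorFrame L dW eW dV') (tensorFrame_real L dW hdW eW dV' hdV'))
        (sB (tensorEmb L e dV hdV dW hdW eW e' dV' hdV' (k : HA L e dV hdV dW hdW))) Φ))) :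
    ∃ V : Submodule ℂ 𝓢(((Fin (n' + n')) → mixedSpace (Fp L)), ℂ), FiniteDimensional ℂ V ∧
      (∀ ainf : UnitaryGroup.arch (Fp L) L (IsCMField.complexConj L) (n + n) (hermD L e dV hdV dW hdW),
        (UnitaryGroup.archToAdelic (Fp L) L (IsCMField.complexConj L) (n + n) (hermD L e dV hdV dW hdW) ainf : HA L e dV hdV dW hdW) ∈ 𝒦.K →
        ∀ a ∈ V, ∃ a' ∈ V, ∀ f : FinSB (Fp L) (Fin (n' + n')),
          adelicMpCont.omega (Fp L) (Fin (n' + n')) (gramDA L e' dV hdV (tensorFrame L dW eW dV') (tensorFrame_real L dW hdW eW dV' hdV'))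
              (sB (tensorEmb L e dV hdV dW hdW eW e' dV' hdV'
                (UnitaryGroup.archToAdelic (Fp L) L (IsCMField.complexConj L) (n + n) (hermD L e dV hdV dW hdW) ainf)))
              (piSchwartzBruhatEquiv (Fp L) (Fin (n' + n')) (a ⊗ₜ[ℂ] f)) =
            piSchwartzBruhatEquiv (Fp L) (Fin (n' + n')) (a' ⊗ₜ[ℂ] f)) ∧
      Φ ∈ Submodule.span ℂ {x : piSchwartzBruhat (Fp L) (Fin (n' + n')) |
        ∃ a ∈ V, ∃ f : FinSB (Fp L) (Fin (n' + n')), x = piSchwartzBruhatEquiv (Fp L) (Fin (n' + n')) (a ⊗ₜ[ℂ] f)} := by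
  -- abbreviations (local `let`s, no definitions)
  let ω : HA L e' dV hdV (tensorFrame L dW eW dV') (tensorFrame_real L dW hdW eW dV' hdV') →
      (piSchwartzBruhat (Fp L) (Fin (n' + n')) →ₗ[ℂ] piSchwartzBruhat (Fp L) (Fin (n' + n'))) := fun g =>
    adelicMpCont.omega (Fp L) (Fin (n' + n')) (gramDA L e' dV hdV (tensorFrame L dW eW dV') (tensorFrame_real L dW hdW eW dV' hdV')) (sB g)
  let E := piSchwartzBruhatEquiv (Fp L) (Fin (n' + n'))
  let ιT := tensorEmb L e dV hdV dW hdW eW e' dV' hdV'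
  let D : Submodule ℂ (piSchwartzBruhat (Fp L) (Fin (n' + n'))) := Submodule.span ℂ (Set.range fun k : 𝒦.K => ω (ιT (k : HA L e dV hdV dW hdW)) Φ)
  change FiniteDimensional ℂ D at hΦ
  -- (1a) `Φ ∈ D` (`k = 1`)
  have hΦD : Φ ∈ D := Submodule.subset_span ⟨⟨1, 𝒦.K.one_mem⟩, by
    show ω (ιT 1) Φ = Φ
    simp only [ω, ιT, map_one, Module.End.one_apply]⟩
  -- (1b) `D` is `tensorEmb(𝒦.K)`-stable
  have hDst : ∀ k ∈ 𝒦.K, ∀ Ψ ∈ D, ω (ιT k) Ψ ∈ D := by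
    intro k hk Ψ hΨ
    have hle : D.map (ω (ιT k)) ≤ D := by
      refine Submodule.map_span_le _ _ _ |>.2 ?_
      rintro _ ⟨k', rfl⟩
      refine Submodule.subset_span ⟨⟨k * k', 𝒦.K.mul_mem hk k'.2⟩, ?_⟩
      show ω (ιT (k * (k' : HA L e dV hdV dW hdW))) Φ = ω (ιT k) (ω (ιT (k' : HA L e dV hdV dW hdW)) Φ)
      simp only [ω, ιT, map_mul, Module.End.mul_apply]
    exact hle (Submodule.mem_map_of_mem hΨ)
  -- (2) archimedean elements act by `A ⊗ 1` on pure tensors (D-pin + an odd unitary arch type of `χ_b`)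
  obtain ⟨t, ht, hmod⟩ := hχbs.exists_hasUnitaryArchType hχbu
  have hodd : ∀ w, Odd (t w) := fun w => Int.odd_iff.2 (by have h := hmod w; unfold Int.ModEq at h; omega)
  have hAg : ∀ ainf : UnitaryGroup.arch (Fp L) L (IsCMField.complexConj L) (n + n) (hermD L e dV hdV dW hdW),
      ∃ A : 𝓢(((Fin (n' + n')) → mixedSpace (Fp L)), ℂ) →ₗ[ℂ] 𝓢(((Fin (n' + n')) → mixedSpace (Fp L)), ℂ),
        ∀ (a : 𝓢(((Fin (n' + n')) → mixedSpace (Fp L)), ℂ)) (f : FinSB (Fp L) (Fin (n' + n'))),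
          ω (ιT (UnitaryGroup.archToAdelic (Fp L) L (IsCMField.complexConj L) (n + n) (hermD L e dV hdV dW hdW) ainf)) (E (a ⊗ₜ[ℂ] f)) =
            E (A a ⊗ₜ[ℂ] f) := by
    intro ainf
    have hg := tensorEmb_archToAdelic L e dV hdV dW hdW eW e' dV' hdV' ainf
    obtain ⟨A, hA⟩ := exists_linearMap_of_forall_eq_smul_cle (fun a f =>
      omega_sD_archToAdelic_tmul L e' dV hdV hdV0 (tensorFrame L dW eW dV') (tensorFrame_real L dW hdW eW dV' hdV')
        (tensorFrame_ne_zero L dW eW dV' hdW0 hdV'0) hχbu hχbs hsB ht hodd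
        (UnitaryGroup.archPart (Fp L) L (IsCMField.complexConj L) (n' + n')
          (hermD L e' dV hdV (tensorFrame L dW eW dV') (tensorFrame_real L dW hdW eW dV' hdV'))
          (tensorEmb L e dV hdV dW hdW eW e' dV' hdV'
            (UnitaryGroup.archToAdelic (Fp L) L (IsCMField.complexConj L) (n + n) (hermD L e dV hdV dW hdW) ainf))) a f)
    exact ⟨A, fun a f => (congrArg (fun y => ω y (E (a ⊗ₜ[ℂ] f))) hg).trans (hA a f)⟩
  -- (3) coordinates in a basis `bN` of `𝒮_f`: `c d i := κ_i(E⁻¹ d)`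
  let bN := Module.Basis.ofVectorSpace ℂ (FinSB (Fp L) (Fin (n' + n')))
  let cf : piSchwartzBruhat (Fp L) (Fin (n' + n')) →
      (Module.Basis.ofVectorSpaceIndex ℂ (FinSB (Fp L) (Fin (n' + n'))) →₀ 𝓢(((Fin (n' + n')) → mixedSpace (Fp L)), ℂ)) := fun d =>
    TensorProduct.finsuppScalarRight ℂ ℂ 𝓢(((Fin (n' + n')) → mixedSpace (Fp L)), ℂ) (Module.Basis.ofVectorSpaceIndex ℂ (FinSB (Fp L) (Fin (n' + n'))))
      (TensorProduct.congr (LinearEquiv.refl ℂ _) bN.repr (E.symm d))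
  have hcf_zero : cf 0 = 0 := by simp only [cf, map_zero]
  have hcf_add : ∀ x y, cf (x + y) = cf x + cf y := fun x y => by simp only [cf, map_add]
  have hcf_smul : ∀ (r : ℂ) x, cf (r • x) = r • cf x := fun r x => by simp only [cf, map_smul]
  -- a finite spanning set of `D` and the span `V` of its (finitely many non-zero) coordinates
  obtain ⟨S, hS⟩ := (Submodule.fg_iff_finiteDimensional D).2 hΦ
  let T : Finset 𝓢(((Fin (n' + n')) → mixedSpace (Fp L)), ℂ) := S.biUnion fun d => (cf d).support.image fun i => cf d i
  let V : Submodule ℂ 𝓢(((Fin (n' + n')) → mixedSpace (Fp L)), ℂ) := Submodule.span ℂ (T : Set _)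
  -- (P1) every coordinate of every element of `D` lies in `V`
  have hκ : ∀ i, ∀ d ∈ D, cf d i ∈ V := by
    intro i d hd
    rw [← hS] at hd
    induction hd using Submodule.span_induction with
    | mem d hdS =>
      by_cases hi : i ∈ (cf d).support
      · exact Submodule.subset_span (Finset.mem_coe.2 (Finset.mem_biUnion.2 ⟨d, hdS, Finset.mem_image.2 ⟨i, hi, rfl⟩⟩))
      · rw [Finsupp.notMem_support_iff.1 hi]
        exact V.zero_mem
    | zero =>
      rw [hcf_zero, Finsupp.coe_zero, Pi.zero_apply]
      exact V.zero_mem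
    | add x y _ _ hx hy =>
      rw [hcf_add, Finsupp.coe_add, Pi.add_apply]
      exact V.add_mem hx hy
    | smul r x _ hx =>
      rw [hcf_smul, Finsupp.coe_smul, Pi.smul_apply]
      exact V.smul_mem r hx
  refine ⟨V, FiniteDimensional.span_of_finite ℂ T.finite_toSet, ?_, ?_⟩
  · -- (P3) stability under the archimedean elements of `𝒦.K`
    intro ainf hainf a ha
    obtain ⟨A, hA⟩ := hAg ainf
    -- `E ∘ (A ⊗ 1) = ω(g) ∘ E` on all of `𝒮_∞ ⊗ 𝒮_f`
    have hAE : ∀ u, E (TensorProduct.map A LinearMap.id u) =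
        ω (ιT (UnitaryGroup.archToAdelic (Fp L) L (IsCMField.complexConj L) (n + n) (hermD L e dV hdV dW hdW) ainf)) (E u) := by
      intro u
      induction u using TensorProduct.induction_on with
      | zero => simp only [map_zero]
      | tmul a' f => rw [TensorProduct.map_tmul, LinearMap.id_apply, hA]
      | add x y hx hy => simp only [map_add, hx, hy]
    -- `A V ≤ V`: on the generators `c d i`, `A(c d i) = c (ω(g) d) i` with `ω(g) d ∈ D` (term mode: no `rw` under `ιT (archToAdelic _)`)
    have hgen : ∀ y ∈ (T : Set 𝓢(((Fin (n' + n')) → mixedSpace (Fp L)), ℂ)), A y ∈ V := by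
      intro y hy
      obtain ⟨d, hd, hy⟩ := Finset.mem_biUnion.1 (Finset.mem_coe.1 hy)
      obtain ⟨i, -, rfl⟩ := Finset.mem_image.1 hy
      have hdD : d ∈ D := by rw [← hS]; exact Submodule.subset_span hd
      have hmap : TensorProduct.map A LinearMap.id (E.symm d) =
          E.symm (ω (ιT (UnitaryGroup.archToAdelic (Fp L) L (IsCMField.complexConj L) (n + n) (hermD L e dV hdV dW hdW) ainf)) d) :=
        E.eq_symm_apply.2 ((hAE (E.symm d)).trans
          (congrArg (fun z => ω (ιT (UnitaryGroup.archToAdelic (Fp L) L (IsCMField.complexConj L) (n + n) (hermD L e dV hdV dW hdW) ainf)) z)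
            (E.apply_symm_apply d)))
      have key : A (cf d i) = cf (ω (ιT (UnitaryGroup.archToAdelic (Fp L) L (IsCMField.complexConj L) (n + n) (hermD L e dV hdV dW hdW) ainf)) d) i :=
        (coord_map_id bN A (E.symm d) i).symm.trans
          (congrArg (fun u => TensorProduct.finsuppScalarRight ℂ ℂ 𝓢(((Fin (n' + n')) → mixedSpace (Fp L)), ℂ)
            (Module.Basis.ofVectorSpaceIndex ℂ (FinSB (Fp L) (Fin (n' + n')))) (TensorProduct.congr (LinearEquiv.refl ℂ _) bN.repr u) i) hmap)
      exact Eq.mpr (congrArg (fun z => z ∈ V) key) (hκ i _ (hDst _ hainf d hdD))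
    have hAV : ∀ y ∈ V, A y ∈ V := by
      intro y hy
      induction hy using Submodule.span_induction with
      | mem y hyT => exact hgen y hyT
      | zero => rw [map_zero]; exact V.zero_mem
      | add x y _ _ hx hy => rw [map_add]; exact V.add_mem hx hy
      | smul r x _ hx => rw [map_smul]; exact V.smul_mem r hx
    exact ⟨A a, hAV a ha, fun f => hA a f⟩
  · -- (P2) `Φ ∈ E(V ⊗ 𝒮_f)`: `E⁻¹Φ` has all coordinates in `V` (P1), so lies in `V ⊗ 𝒮_f` (§0), and `E` maps `w ⊗ x` to a generator
    have ht : E.symm Φ ∈ Submodule.span ℂ {y | ∃ w ∈ V, ∃ x : FinSB (Fp L) (Fin (n' + n')), y = w ⊗ₜ[ℂ] x} :=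
      mem_span_tmul_of_coord_mem bN V (E.symm Φ) fun i => hκ i Φ hΦD
    have hE : ∀ u ∈ Submodule.span ℂ {y | ∃ w ∈ V, ∃ x : FinSB (Fp L) (Fin (n' + n')), y = w ⊗ₜ[ℂ] x},
        E u ∈ Submodule.span ℂ {x : piSchwartzBruhat (Fp L) (Fin (n' + n')) |
          ∃ a ∈ V, ∃ f : FinSB (Fp L) (Fin (n' + n')), x = piSchwartzBruhatEquiv (Fp L) (Fin (n' + n')) (a ⊗ₜ[ℂ] f)} := by
      intro u hu
      induction hu using Submodule.span_induction with
      | mem u hu =>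
        obtain ⟨w, hw, x, rfl⟩ := hu
        exact Submodule.subset_span ⟨w, hw, x, rfl⟩
      | zero => rw [map_zero]; exact Submodule.zero_mem _
      | add x y _ _ hx hy => rw [map_add]; exact Submodule.add_mem _ hx hy
      | smul r x _ hx => rw [map_smul]; exact Submodule.smul_mem _ r hx
    have hΦ' := hE _ ht
    rwa [LinearEquiv.apply_symm_apply] at hΦ'

end Summit.HodgeConjecture.HodgeConjecture.Cruxes.HLiu418.K2LiuRigidityDomainKFiniteConverse

end
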